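import Summits.QuantumFields.YangMills.Theorems.FlatTubeReductionSymmetricKernelRatio
import Summits.QuantumFields.YangMills.Theorems.LuscherReductionTwistedTraceScalingBTOffDiagonalRatio
import Summits.QuantumFields.YangMills.Theorems.LuscherReductionTwistedTraceScalingBTCoreWeight
import HarnessLib

/-!
# The SYMMETRIC NEAR-PAIR RATIO of the colour-localised BO kernel: `|f(u,u')² − f(u,u)f(u',u')| ≤ (ξ + 120η²)·f(u,u)f(u',u')`, `f = fpBOKernel/K₁`, from the pointwise bounds
# `|offX(u,u')|, |offX(u',u)| ≤ η` and `|offX(u,u') + offX(u',u)| ≤ ξ` on the support — the involution `(v,v',g) ↦ (v',v,g⁻¹)` kills the first order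
# (route `FlatTubeReduction`, crux K1 `NearFlatRatioLaw` stmt-QuantumFields-24720; seat `ym-line-ftr-p1` g15; rate twin «ratepack-v3 / frozen fibres»; R2b1 RECORD rung — no summit
# statement is proved here)

WHY (memo `Cruxes/NearFlatRatioLaw/Lines/ratepack-v3-frozen-g12.md` §5.1, §8.4; PICKED.md g15).  Lane A's near-pair engine `…BTOffDiagonalRatio.fpBOKernel_offdiag_two_sided` integrates the
pointwise bound `|offX| ≤ η` to `e^{−η}f(u,u) ≤ f(u,u') ≤ e^{η}f(u,u)` — first order, `η ≍ β^{-1/3}` on the `β^{-1/6}` window.  The rate twin's `hT` needs the DRESSED comparison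
`f(u,u') ≈ √(f(u,u)f(u',u'))` at relative precision `O(λ_b²)`.  This file instantiates the abstract `…SymmetricKernelRatio.symmetric_kernel_ratio` on the product space
`V × (V × G)` of `…BTProductForm` (`f(u,u') = ∫ fpTriple/K₁`):
* `integral_tripleFlip` — the product measure `π ⊗ π ⊗ Haar` is invariant under `(v,v',g) ↦ (v',v,g⁻¹)` (Fubini swap + inversion invariance of Haar);
* the exponents `E_{ab}(v,v',g) = log K_β(oT a v, (oT b v')^g) − log K₁^{(L³β)}(a,b)`: `E_{uu'} − E_{uu} = offX(u,u')`, and under the flip `E_{uu'} ↦ E_{u'u}`, `E_{uu}, E_{u'u'}` fixed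
  (`transferKernel_gaugeTransform_right_eq`, symmetry of `K₁`), so for an inversion-symmetric weight `W` the symmetry integrals of the abstract lemma vanish and `fpBOKernel` is symmetric
  (★ `fpBOKernel_symm`);
* ★★★ `fpBOKernel_symm_ratio` — `|f(u,u')f(u',u) − f(u,u)f(u',u')| ≤ (ξ + 120η²)f(u,u)f(u',u')`; ★★★ `fpBOKernel_near_dressed` — `|f(u,u') − √(f(u,u))√(f(u',u'))| ≤ (ξ + 120η²)√(f(u,u))√(f(u',u'))`.
With lane A's `abs_offX_le` (`η`, split radii) and `…KernelMixedDifference.abs_offX_add_offX_swap_le` (`ξ = O(β⁻¹polylog)`) this is the K-near input of `stub_coreRateOfEM` with the exact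
diagonal dressing `√f(u,u)`; relative error `O(β^{-2/3}) = O(λ_b²)`.
HONEST FRAMING: measure-theoretic bookkeeping for a stub of the CONDITIONAL reduction route R2b1; the far pairs / tails / schedule of (B-T) at rate remain; femto rung R2b1 (RECORD label);
not infinite volume, not a gap, not Clay.  No defs, no named facts, no `sorry`.
-/

set_option autoImplicit false

noncomputable section

open MeasureTheory Filter Topology Real
open scoped BigOperators
open Literature.MathematicalPhysics.QuantumFieldTheory
open Literature.MathematicalPhysics.QuantumLattice

namespace Summit.QuantumFields.YangMills.Theorems.FemtoTransferGap.TwoLattice.ConstTube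

open Summit.QuantumFields.YangMills.Theorems.FemtoTransferGap
open Summit.QuantumFields.YangMills.Theorems.FemtoTransferGap.TwoLattice
open Summit.QuantumFields.YangMills.Theorems.FemtoTransferGap.TwoLattice.Avg
open Summit.QuantumFields.YangMills.Theorems.FemtoTransferGap.TwoLattice.Stiff (LinkSpace)

variable {L : ℕ} [NeZero L]

/-! ## §1 The involution `(v,v',g) ↦ (v',v,g⁻¹)` preserves `π ⊗ π ⊗ Haar` -/

/-- ★ `∫ F(v',v,g⁻¹) = ∫ F(v,v',g)` over `π ⊗ (π ⊗ Haar)` (Fubini swap + inversion invariance of the Haar measure of the gauge group). [folklore] -/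
theorem integral_tripleFlip (F : (Edge 3 L → Fin 3 → ℝ) × ((Edge 3 L → Fin 3 → ℝ) × (Site 3 L → SU2)) → ℝ) :
    ∫ p, F (p.2.1, (p.1, p.2.2⁻¹)) ∂((orthoTransverse L).prod ((orthoTransverse L).prod (gaugeMeasure L))) =
      ∫ p, F p ∂((orthoTransverse L).prod ((orthoTransverse L).prod (gaugeMeasure L))) := by
  haveI := isFiniteMeasure_orthoTransverse L
  haveI : SecondCountableTopology SU2 := secondCountableTopology_su2
  haveI : (gaugeMeasure L).IsInvInvariant := by unfold gaugeMeasure; infer_instance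
  obtain ⟨e, he⟩ : ∃ e : (Edge 3 L → Fin 3 → ℝ) × ((Edge 3 L → Fin 3 → ℝ) × (Site 3 L → SU2)) ≃ᵐ (Edge 3 L → Fin 3 → ℝ) × ((Edge 3 L → Fin 3 → ℝ) × (Site 3 L → SU2)),
      ∀ p, e p = (p.2.1, (p.1, p.2.2⁻¹)) :=
    ⟨MeasurableEquiv.prodAssoc.symm.trans ((MeasurableEquiv.prodComm.prodCongr (MeasurableEquiv.inv (Site 3 L → SU2))).trans MeasurableEquiv.prodAssoc), fun _ => rfl⟩
  have hmp : MeasurePreserving e ((orthoTransverse L).prod ((orthoTransverse L).prod (gaugeMeasure L))) ((orthoTransverse L).prod ((orthoTransverse L).prod (gaugeMeasure L))) := by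
    have h1 := (measurePreserving_prodAssoc (orthoTransverse L) (orthoTransverse L) (gaugeMeasure L)).symm
    have h2 : MeasurePreserving (Prod.map Prod.swap Inv.inv) (((orthoTransverse L).prod (orthoTransverse L)).prod (gaugeMeasure L))
        (((orthoTransverse L).prod (orthoTransverse L)).prod (gaugeMeasure L)) := (Measure.measurePreserving_swap).prod (Measure.measurePreserving_inv (gaugeMeasure L))
    have h3 := (measurePreserving_prodAssoc (orthoTransverse L) (orthoTransverse L) (gaugeMeasure L)).comp (h2.comp h1)
    refine ⟨e.measurable, ?_⟩
    have hfun : (e : _ → _) = (MeasurableEquiv.prodAssoc ∘ Prod.map Prod.swap Inv.inv ∘ MeasurableEquiv.prodAssoc.symm) := by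
      funext p; rw [he]; rfl
    rw [hfun]; exact h3.map_eq
  have h := hmp.integral_comp e.measurableEmbedding F
  simp only [he] at h
  exact h

/-! ## §2 The exponents -/

omit [NeZero L] in
/-- `log K_β(U,V) = β·TC(U,V) − (β/2)(S(U) + S(V))`. [folklore] -/
theorem log_transferKernel {M : ℕ} [NeZero M] (β : ℝ) (U V : GaugeConfig 3 M SU2) :
    Real.log (transferKernel su2Rep β U V) = β * timeCoupling su2Rep U V - β / 2 * (wilsonAction su2Rep U + wilsonAction su2Rep V) := by
  unfold transferKernel; rw [Real.log_exp]

/-- The off-diagonal exponent is the difference of log-ratios: `[log K(oT u v, (oT u' v')^g) − log K₁(u,u')] − [log K(oT u v, (oT u v')^g) − log K₁(u,u)] = offX β u u' v v' g`. [folklore] -/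
theorem logRatio_sub_logRatio_eq_offX (β : ℝ) (u u' : GaugeConfig 3 1 SU2) (v v' : Edge 3 L → Fin 3 → ℝ) (g : Site 3 L → SU2) :
    (Real.log (transferKernel su2Rep β (orthoTube L u v) (gaugeTransform g (orthoTube L u' v'))) - Real.log (transferKernel su2Rep ((L : ℝ) ^ 3 * β) u u')) -
        (Real.log (transferKernel su2Rep β (orthoTube L u v) (gaugeTransform g (orthoTube L u v'))) - Real.log (transferKernel su2Rep ((L : ℝ) ^ 3 * β) u u)) =
      offX L β u u' v v' g := by
  simp only [log_transferKernel, wilsonAction_gaugeTransform]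
  unfold offX; ring

/-- Under the flip: `K_β(oT a v', (oT b v)^{g⁻¹}) = K_β(oT b v, (oT a v')^g)`. [folklore] -/
theorem transferKernel_orthoTube_flip (β : ℝ) (a b : GaugeConfig 3 1 SU2) (v v' : Edge 3 L → Fin 3 → ℝ) (g : Site 3 L → SU2) :
    transferKernel su2Rep β (orthoTube L a v') (gaugeTransform g⁻¹ (orthoTube L b v)) = transferKernel su2Rep β (orthoTube L b v) (gaugeTransform g (orthoTube L a v')) :=
  (transferKernel_gaugeTransform_right_eq β g (orthoTube L b v) (orthoTube L a v')).symm

/-! ## §3 ★ Symmetry of `fpBOKernel` for an inversion-symmetric weight -/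

/-- ★ **`fpBOKernel β Ω W u u' = fpBOKernel β Ω W u' u`** for bounded measurable `Ω` and an inversion-symmetric bounded measurable weight `W`. [cite: Luscher1983, §3] -/
theorem fpBOKernel_symm (β : ℝ) {Ω : LinkSpace L → ℝ} (hΩm : Measurable Ω) {CΩ : ℝ} (hCΩ : ∀ x, |Ω x| ≤ CΩ)
    {W : (Site 3 L → SU2) → ℝ} (hW : Measurable W) {CW : ℝ} (hCW : ∀ g, |W g| ≤ CW) (hWinv : ∀ g, W g⁻¹ = W g) (u u' : GaugeConfig 3 1 SU2) :
    fpBOKernel L β Ω W u u' = fpBOKernel L β Ω W u' u := by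
  rw [fpBOKernel_eq_integral_prod β hΩm hCΩ hW hCW, fpBOKernel_eq_integral_prod β hΩm hCΩ hW hCW,
    ← integral_tripleFlip (fpTriple L β Ω W u u')]
  refine integral_congr_ae (ae_of_all _ fun p => ?_)
  unfold fpTriple
  dsimp only
  rw [hWinv, transferKernel_orthoTube_flip]; ring

/-! ## §4 ★★★ The symmetric near-pair ratio -/

set_option maxHeartbeats 800000 in
/-- ★★★ **SYMMETRIC NEAR-PAIR RATIO.**  `Ω ≥ 0` bounded measurable, `W ≥ 0` bounded measurable and inversion symmetric; on the support (`Ω(v̂), Ω(v̂'), W(g) ≠ 0`):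
`|offX β u u' v v' g| ≤ η`, `|offX β u' u v v' g| ≤ η` (`η ≤ 1`) and `|offX β u u' v v' g + offX β u' u v v' g| ≤ ξ`.  Then, with `f(a,b) = fpBOKernel β Ω W a b / K₁^{(L³β)}(a,b)`:
`|f(u,u')·f(u',u) − f(u,u)·f(u',u')| ≤ (ξ + 120η²)·f(u,u)·f(u',u')`. [cite: Luscher1983, §3] -/
theorem fpBOKernel_symm_ratio (β : ℝ) {Ω : LinkSpace L → ℝ} (hΩm : Measurable Ω) {CΩ : ℝ} (hCΩ : ∀ x, |Ω x| ≤ CΩ) (hΩ0 : ∀ x, 0 ≤ Ω x)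
    {W : (Site 3 L → SU2) → ℝ} (hW : Measurable W) {CW : ℝ} (hCW : ∀ g, |W g| ≤ CW) (hW0 : ∀ g, 0 ≤ W g) (hWinv : ∀ g, W g⁻¹ = W g) (u u' : GaugeConfig 3 1 SU2)
    {η ξ : ℝ} (hη0 : 0 ≤ η) (hη1 : η ≤ 1)
    (hη : ∀ (v v' : Edge 3 L → Fin 3 → ℝ) (g : Site 3 L → SU2), Ω (linkEmbed L v) ≠ 0 → Ω (linkEmbed L v') ≠ 0 → W g ≠ 0 →
      |offX L β u u' v v' g| ≤ η ∧ |offX L β u' u v v' g| ≤ η)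
    (hξ : ∀ (v v' : Edge 3 L → Fin 3 → ℝ) (g : Site 3 L → SU2), Ω (linkEmbed L v) ≠ 0 → Ω (linkEmbed L v') ≠ 0 → W g ≠ 0 →
      |offX L β u u' v v' g + offX L β u' u v v' g| ≤ ξ) :
    |fpBOKernel L β Ω W u u' / transferKernel su2Rep ((L : ℝ) ^ 3 * β) u u' * (fpBOKernel L β Ω W u' u / transferKernel su2Rep ((L : ℝ) ^ 3 * β) u' u) -
        fpBOKernel L β Ω W u u / transferKernel su2Rep ((L : ℝ) ^ 3 * β) u u * (fpBOKernel L β Ω W u' u' / transferKernel su2Rep ((L : ℝ) ^ 3 * β) u' u')| ≤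
      (ξ + 120 * η ^ 2) * (fpBOKernel L β Ω W u u / transferKernel su2Rep ((L : ℝ) ^ 3 * β) u u * (fpBOKernel L β Ω W u' u' / transferKernel su2Rep ((L : ℝ) ^ 3 * β) u' u')) := by
  haveI := isFiniteMeasure_orthoTransverse L
  haveI : SecondCountableTopology SU2 := secondCountableTopology_su2
  set μP : Measure ((Edge 3 L → Fin 3 → ℝ) × ((Edge 3 L → Fin 3 → ℝ) × (Site 3 L → SU2))) := (orthoTransverse L).prod ((orthoTransverse L).prod (gaugeMeasure L)) with hμP
  haveI : IsFiniteMeasure μP := by rw [hμP]; infer_instance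
  -- the density and the exponents
  obtain ⟨q, hq⟩ : ∃ q : (Edge 3 L → Fin 3 → ℝ) × ((Edge 3 L → Fin 3 → ℝ) × (Site 3 L → SU2)) → ℝ, q = fun p => Ω (linkEmbed L p.1) * (W p.2.2 * Ω (linkEmbed L p.2.1)) := ⟨_, rfl⟩
  obtain ⟨E, hE⟩ : ∃ E : GaugeConfig 3 1 SU2 → GaugeConfig 3 1 SU2 → (Edge 3 L → Fin 3 → ℝ) × ((Edge 3 L → Fin 3 → ℝ) × (Site 3 L → SU2)) → ℝ,
      E = fun a b p => Real.log (transferKernel su2Rep β (orthoTube L a p.1) (gaugeTransform p.2.2 (orthoTube L b p.2.1))) - Real.log (transferKernel su2Rep ((L : ℝ) ^ 3 * β) a b) :=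
    ⟨_, rfl⟩
  have hq0 : ∀ p, 0 ≤ q p := fun p => by rw [hq]; exact mul_nonneg (hΩ0 _) (mul_nonneg (hW0 _) (hΩ0 _))
  have hqm : Measurable q := by
    rw [hq]
    exact (hΩm.comp ((measurable_linkEmbed L).comp measurable_fst)).mul
      ((hW.comp (measurable_snd.comp measurable_snd)).mul (hΩm.comp ((measurable_linkEmbed L).comp (measurable_fst.comp measurable_snd))))
  have hEm : ∀ a b, Measurable (E a b) := fun a b => by
    have hK : Measurable fun z : GaugeConfig 3 L SU2 × GaugeConfig 3 L SU2 => transferKernel su2Rep β z.1 z.2 :=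
      (continuous_transferKernel su2Rep continuous_su2Rep β).measurable
    have h1 : Measurable fun p : (Edge 3 L → Fin 3 → ℝ) × ((Edge 3 L → Fin 3 → ℝ) × (Site 3 L → SU2)) => orthoTube L a p.1 :=
      (measurable_orthoTube_right (L := L) a).comp measurable_fst
    have h2 : Measurable fun p : (Edge 3 L → Fin 3 → ℝ) × ((Edge 3 L → Fin 3 → ℝ) × (Site 3 L → SU2)) => gaugeTransform p.2.2 (orthoTube L b p.2.1) := by
      have ha : Measurable fun p : (Edge 3 L → Fin 3 → ℝ) × ((Edge 3 L → Fin 3 → ℝ) × (Site 3 L → SU2)) => (orthoTube L b p.2.1, p.2.2) :=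
        ((measurable_orthoTube_right (L := L) b).comp (measurable_fst.comp measurable_snd)).prodMk (measurable_snd.comp measurable_snd)
      have h := (measurable_gaugeAction (L := L)).comp ha
      simpa only [Function.comp_def] using h
    have hK' : Measurable fun p : (Edge 3 L → Fin 3 → ℝ) × ((Edge 3 L → Fin 3 → ℝ) × (Site 3 L → SU2)) =>
        transferKernel su2Rep β (orthoTube L a p.1) (gaugeTransform p.2.2 (orthoTube L b p.2.1)) := by
      have h := hK.comp (h1.prodMk h2); simpa only [Function.comp_def] using h
    rw [hE]; exact hK'.log.sub measurable_const
  -- `q·e^{E_ab} = fpTriple(a,b)/K₁(a,b)`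
  have hqE : ∀ a b p, q p * Real.exp (E a b p) = fpTriple L β Ω W a b p / transferKernel su2Rep ((L : ℝ) ^ 3 * β) a b := fun a b p => by
    rw [hq, hE]; dsimp only
    rw [Real.exp_sub, Real.exp_log (transferKernel_pos _ _ _ _), Real.exp_log (transferKernel_pos _ _ _ _)]
    unfold fpTriple; ring
  have hF : ∀ a b, ∫ p, q p * Real.exp (E a b p) ∂μP = fpBOKernel L β Ω W a b / transferKernel su2Rep ((L : ℝ) ^ 3 * β) a b := fun a b => by
    simp_rw [hqE a b]
    rw [integral_div, hμP, ← fpBOKernel_eq_integral_prod β hΩm hCΩ hW hCW]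
  have hI : ∀ a b, Integrable (fun p => q p * Real.exp (E a b p)) μP := fun a b => by
    obtain ⟨B, hB⟩ := abs_fpTriple_le (L := L) β hCΩ hCW a b
    have hK0 : 0 < transferKernel su2Rep ((L : ℝ) ^ 3 * β) a b := transferKernel_pos _ _ _ _
    simp_rw [hqE a b]
    exact integrable_of_measurable_abs_le _ ((measurable_fpTriple β hΩm hW a b).div_const _) (C := B / transferKernel su2Rep ((L : ℝ) ^ 3 * β) a b)
      fun p => by rw [abs_div, abs_of_pos hK0]; exact div_le_div_of_nonneg_right (hB p) hK0.le
  -- exponent identities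
  have hE12 : ∀ p, E u u' p - E u u p = offX L β u u' p.1 p.2.1 p.2.2 := fun p => by rw [hE]; exact logRatio_sub_logRatio_eq_offX β u u' p.1 p.2.1 p.2.2
  have hE21 : ∀ p, E u' u p - E u' u' p = offX L β u' u p.1 p.2.1 p.2.2 := fun p => by rw [hE]; exact logRatio_sub_logRatio_eq_offX β u' u p.1 p.2.1 p.2.2
  have hEflip : ∀ (a b) (p : (Edge 3 L → Fin 3 → ℝ) × ((Edge 3 L → Fin 3 → ℝ) × (Site 3 L → SU2))), E a b (p.2.1, (p.1, p.2.2⁻¹)) = E b a p := fun a b p => by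
    rw [hE]; dsimp only; rw [transferKernel_orthoTube_flip, transferKernel_su2Rep_symm ((L : ℝ) ^ 3 * β) a b]
  have hE12' : ∀ p : (Edge 3 L → Fin 3 → ℝ) × ((Edge 3 L → Fin 3 → ℝ) × (Site 3 L → SU2)), E u u' p - E u' u' p = offX L β u' u p.2.1 p.1 p.2.2⁻¹ := fun p => by
    rw [← hEflip u' u p, ← hEflip u' u' p]; exact hE21 (p.2.1, (p.1, p.2.2⁻¹))
  have hE21' : ∀ p : (Edge 3 L → Fin 3 → ℝ) × ((Edge 3 L → Fin 3 → ℝ) × (Site 3 L → SU2)), E u' u p - E u u p = offX L β u u' p.2.1 p.1 p.2.2⁻¹ := fun p => by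
    rw [← hEflip u u' p, ← hEflip u u p]; exact hE12 (p.2.1, (p.1, p.2.2⁻¹))
  -- support of `q`
  have hsupp : ∀ p, q p ≠ 0 → Ω (linkEmbed L p.1) ≠ 0 ∧ Ω (linkEmbed L p.2.1) ≠ 0 ∧ W p.2.2 ≠ 0 := fun p hp => by
    rw [hq] at hp
    refine ⟨fun h => hp ?_, fun h => hp ?_, fun h => hp ?_⟩ <;> simp [h]
  have hqflip : ∀ p : (Edge 3 L → Fin 3 → ℝ) × ((Edge 3 L → Fin 3 → ℝ) × (Site 3 L → SU2)), q (p.2.1, (p.1, p.2.2⁻¹)) = q p := fun p => by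
    rw [hq]; dsimp only; rw [hWinv]; ring
  -- the pointwise hypotheses
  have hb : ∀ p, q p ≠ 0 → |E u u' p - E u u p| ≤ η ∧ |E u' u p - E u u p| ≤ η ∧ |E u u' p - E u' u' p| ≤ η ∧ |E u' u p - E u' u' p| ≤ η ∧
      |E u u' p + E u' u p - E u u p - E u' u' p| ≤ ξ := fun p hp => by
    obtain ⟨h1, h2, h3⟩ := hsupp p hp
    have h3' : W p.2.2⁻¹ ≠ 0 := by rw [hWinv]; exact h3
    obtain ⟨a1, a2⟩ := hη p.1 p.2.1 p.2.2 h1 h2 h3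
    obtain ⟨b1, b2⟩ := hη p.2.1 p.1 p.2.2⁻¹ h2 h1 h3'
    refine ⟨by rw [hE12]; exact a1, by rw [hE21']; exact b1, by rw [hE12']; exact b2, by rw [hE21]; exact a2, ?_⟩
    have e : E u u' p + E u' u p - E u u p - E u' u' p = offX L β u u' p.1 p.2.1 p.2.2 + offX L β u' u p.1 p.2.1 p.2.2 := by rw [← hE12, ← hE21]; ring
    rw [e]; exact hξ p.1 p.2.1 p.2.2 h1 h2 h3
  -- the symmetry integrals
  have hS : ∀ a, (∀ p : (Edge 3 L → Fin 3 → ℝ) × ((Edge 3 L → Fin 3 → ℝ) × (Site 3 L → SU2)), E a a (p.2.1, (p.1, p.2.2⁻¹)) = E a a p) →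
      ∫ p, q p * Real.exp (E a a p) * (E u u' p - E u' u p) ∂μP = 0 := fun a ha => by
    have h := integral_tripleFlip (L := L) (fun p => q p * Real.exp (E a a p) * (E u u' p - E u' u p))
    have e : (fun p : (Edge 3 L → Fin 3 → ℝ) × ((Edge 3 L → Fin 3 → ℝ) × (Site 3 L → SU2)) =>
        q (p.2.1, (p.1, p.2.2⁻¹)) * Real.exp (E a a (p.2.1, (p.1, p.2.2⁻¹))) * (E u u' (p.2.1, (p.1, p.2.2⁻¹)) - E u' u (p.2.1, (p.1, p.2.2⁻¹)))) =
        fun p => -(q p * Real.exp (E a a p) * (E u u' p - E u' u p)) := by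
      funext p; rw [hqflip, ha, hEflip, hEflip]; ring
    rw [e, integral_neg, ← hμP] at h
    linarith
  have h := RateTube.symmetric_kernel_ratio (μ := μP) hq0 hqm (hEm u u) (hEm u u') (hEm u' u) (hEm u' u') (hI u u) (hI u u') (hI u' u) (hI u' u') hη0 hη1 hb
    (hS u (hEflip u u)) (hS u' (hEflip u' u'))
  rw [hF u u', hF u' u, hF u u, hF u' u'] at h
  exact h

/-- ★★★ **THE DRESSED NEAR-PAIR COMPARISON**: under the hypotheses of `fpBOKernel_symm_ratio`, with `f(a,b) = fpBOKernel β Ω W a b / K₁^{(L³β)}(a,b)` and `κ = ξ + 120η²`: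
`|f(u,u') − √f(u,u)·√f(u',u')| ≤ κ·√f(u,u)·√f(u',u')` — the BO kernel is the geometric mean of its diagonal values times the one-site kernel, to second order. [cite: Luscher1983, §3] -/
theorem fpBOKernel_near_dressed (β : ℝ) {Ω : LinkSpace L → ℝ} (hΩm : Measurable Ω) {CΩ : ℝ} (hCΩ : ∀ x, |Ω x| ≤ CΩ) (hΩ0 : ∀ x, 0 ≤ Ω x)
    {W : (Site 3 L → SU2) → ℝ} (hW : Measurable W) {CW : ℝ} (hCW : ∀ g, |W g| ≤ CW) (hW0 : ∀ g, 0 ≤ W g) (hWinv : ∀ g, W g⁻¹ = W g) (u u' : GaugeConfig 3 1 SU2)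
    {η ξ : ℝ} (hη0 : 0 ≤ η) (hη1 : η ≤ 1) (hξ0 : 0 ≤ ξ)
    (hη : ∀ (v v' : Edge 3 L → Fin 3 → ℝ) (g : Site 3 L → SU2), Ω (linkEmbed L v) ≠ 0 → Ω (linkEmbed L v') ≠ 0 → W g ≠ 0 →
      |offX L β u u' v v' g| ≤ η ∧ |offX L β u' u v v' g| ≤ η)
    (hξ : ∀ (v v' : Edge 3 L → Fin 3 → ℝ) (g : Site 3 L → SU2), Ω (linkEmbed L v) ≠ 0 → Ω (linkEmbed L v') ≠ 0 → W g ≠ 0 →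
      |offX L β u u' v v' g + offX L β u' u v v' g| ≤ ξ) :
    |fpBOKernel L β Ω W u u' / transferKernel su2Rep ((L : ℝ) ^ 3 * β) u u' -
        Real.sqrt (fpBOKernel L β Ω W u u / transferKernel su2Rep ((L : ℝ) ^ 3 * β) u u) * Real.sqrt (fpBOKernel L β Ω W u' u' / transferKernel su2Rep ((L : ℝ) ^ 3 * β) u' u')| ≤
      (ξ + 120 * η ^ 2) * (Real.sqrt (fpBOKernel L β Ω W u u / transferKernel su2Rep ((L : ℝ) ^ 3 * β) u u) *
        Real.sqrt (fpBOKernel L β Ω W u' u' / transferKernel su2Rep ((L : ℝ) ^ 3 * β) u' u')) := by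
  have h := fpBOKernel_symm_ratio β hΩm hCΩ hΩ0 hW hCW hW0 hWinv u u' hη0 hη1 hη hξ
  rw [fpBOKernel_symm β hΩm hCΩ hW hCW hWinv u' u, transferKernel_su2Rep_symm ((L : ℝ) ^ 3 * β) u' u] at h
  -- abbreviations (opaque)
  have hf0 : ∀ a b : GaugeConfig 3 1 SU2, 0 ≤ fpBOKernel L β Ω W a b / transferKernel su2Rep ((L : ℝ) ^ 3 * β) a b := fun a b =>
    div_nonneg (fpBOKernel_nonneg β hΩm hCΩ hΩ0 hW hCW hW0 a b) (transferKernel_pos _ _ _ _).le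
  have hA0 := hf0 u u
  have hB0 := hf0 u' u'
  have hx0 := hf0 u u'
  obtain ⟨x, hx⟩ : ∃ x : ℝ, x = fpBOKernel L β Ω W u u' / transferKernel su2Rep ((L : ℝ) ^ 3 * β) u u' := ⟨_, rfl⟩
  obtain ⟨A, hA⟩ : ∃ A : ℝ, A = fpBOKernel L β Ω W u u / transferKernel su2Rep ((L : ℝ) ^ 3 * β) u u := ⟨_, rfl⟩
  obtain ⟨B, hB⟩ : ∃ B : ℝ, B = fpBOKernel L β Ω W u' u' / transferKernel su2Rep ((L : ℝ) ^ 3 * β) u' u' := ⟨_, rfl⟩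
  rw [← hx, ← hA, ← hB] at h ⊢
  rw [← hA] at hA0; rw [← hB] at hB0; rw [← hx] at hx0
  obtain ⟨κ, hκ⟩ : ∃ κ : ℝ, κ = ξ + 120 * η ^ 2 := ⟨_, rfl⟩
  have hκ0 : 0 ≤ κ := by rw [hκ]; positivity
  rw [← hκ] at h ⊢
  obtain ⟨y, hy⟩ : ∃ y : ℝ, y = Real.sqrt A * Real.sqrt B := ⟨_, rfl⟩
  have hy0 : 0 ≤ y := by rw [hy]; exact mul_nonneg (Real.sqrt_nonneg _) (Real.sqrt_nonneg _)
  have hy2 : y ^ 2 = A * B := by rw [hy, mul_pow, Real.sq_sqrt hA0, Real.sq_sqrt hB0]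
  rw [← hy]
  -- `|x² − y²| ≤ κ y²` ⇒ `|x − y| ≤ κ y`
  have h2 : |x ^ 2 - y ^ 2| ≤ κ * y ^ 2 := by rw [hy2, sq]; exact h
  by_cases hxy : x + y = 0
  · have hx' : x = 0 := by linarith
    have hy' : y = 0 := by linarith
    rw [hx', hy']; simp
  have hpos : 0 < x + y := lt_of_le_of_ne (by positivity) (Ne.symm hxy)
  have e : x - y = (x ^ 2 - y ^ 2) / (x + y) := by field_simp; ring
  rw [e, abs_div, abs_of_pos hpos, div_le_iff₀ hpos]
  calc |x ^ 2 - y ^ 2| ≤ κ * y ^ 2 := h2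
    _ = κ * y * y := by ring
    _ ≤ κ * y * (x + y) := mul_le_mul_of_nonneg_left (by linarith) (mul_nonneg hκ0 hy0)

end Summit.QuantumFields.YangMills.Theorems.FemtoTransferGap.TwoLattice.ConstTube

end
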